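/-
Copyright (c) 2026. Released under Apache 2.0 license.
Literature formalization: Chen–Voutier, Theorem 3 for `t ≥ 128`.
-/
import Mathlib
import Literature.NumberTheory.DiophantineGeometry.SimplestQuarticThueMeasure

/-!
# Chen–Voutier's Theorem 3 for `t ≥ 128`

[cite: ChenVoutier1997, Theorem 3 and §3 ("we shall … only prove this theorem for `t ≥ 128`")]

J. H. Chen and P. M. Voutier, *Complete solution of the Diophantine equation `X² + 1 = dY⁴` and a
related family of quartic Thue equations*, J. Number Theory **62** (1997), 71–99.

The part of Theorem 3 that Chen and Voutier prove themselves — for `t ≥ 128` the Thue equations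
`x⁴ - tx³y - 6x²y² + txy³ + y⁴ = ±1` have only the solutions `(±1, 0), (0, ±1)` — assembled
unconditionally from the pieces in this directory: `|y| ≤ 1` (`SimplestQuarticThueProofs`),
`2 ≤ |y| ≤ (t-1)/5` (`SimplestQuarticThueSmallSolutions`, §3.2) and `5|y| ≥ t`
(`SimplestQuarticThueMeasure.no_large_solution`, Theorem 5 + §3.2).
-/

namespace Literature.NumberTheory.DiophantineGeometry.SimplestQuarticThue

/-- **Chen–Voutier, Theorem 3 for `t ≥ 128`** [cite: ChenVoutier1997, Theorem 3]: if `t ≥ 128`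
and `x⁴ - tx³y - 6x²y² + txy³ + y⁴ = ±1` then `(x, y) ∈ {(1,0), (-1,0), (0,1), (0,-1)}`. -/
theorem solutions_of_ge_128 {t : ℤ} (ht : 128 ≤ t) {x y : ℤ}
    (hP : simplestQuarticForm t x y = 1 ∨ simplestQuarticForm t x y = -1) :
    (x, y) ∈ ({(1, 0), (-1, 0), (0, 1), (0, -1)} : Set (ℤ × ℤ)) := by
  rcases le_or_gt |y| 1 with hy | hy
  · rcases simplestQuarticThue_abs_y_le_one (by omega) hP hy with h | ⟨h1, _⟩
    · exact h
    · omega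
  · exfalso
    rcases le_or_gt (5 * |y|) (t - 1) with h5 | h5
    · exact no_solution_of_two_le_abs (by omega) (by omega) h5 hP
    · exact no_large_solution ht (by omega) hP

/-- The same statement in the shape of `SimplestQuarticThueSolutions` restricted to `t ≥ 128`
[cite: ChenVoutier1997, Theorem 3]. -/
theorem simplestQuarticThueSolutions_of_ge_128 {t : ℤ} (ht : 128 ≤ t) (x y : ℤ)
    (hP : simplestQuarticForm t x y = 1 ∨ simplestQuarticForm t x y = -1) :
    (t = 1 ∧ (x, y) ∈ ({(-2, 1), (-1, -2), (-1, 0), (0, 1), (0, -1), (1, 0), (1, 2), (2, -1)} :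
        Set (ℤ × ℤ))) ∨
      (t = 4 ∧ (x, y) ∈ ({(-3, 2), (-2, -3), (-1, 0), (0, 1), (0, -1), (1, 0), (2, 3), (3, -2)} :
        Set (ℤ × ℤ))) ∨
      ((t = 2 ∨ 5 ≤ t) ∧ (x, y) ∈ ({(1, 0), (-1, 0), (0, 1), (0, -1)} : Set (ℤ × ℤ))) :=
  Or.inr (Or.inr ⟨Or.inr (by omega), solutions_of_ge_128 ht hP⟩)

end Literature.NumberTheory.DiophantineGeometry.SimplestQuarticThue
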